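import Mathlib
import Summits.CriticalPhenomena.PercolationContinuityZ3.Theses.PercShatteringRace
import Literature.Probability.Percolation.GMFiniteSize
import Literature.Probability.Percolation.InequalitiesProofs
import Literature.Probability.Percolation.ConnectivityProofs
import Literature.Probability.Percolation.PercolationProofs
import HarnessLib

/-!
# CriticalPhenomena / PercolationContinuityZ3 — route PercShatteringRace, item `JumpUniquenessBoxLRO`

Settles `stmt-CriticalPhenomena-5787` (support, rank 9): for every `α > 1`, if at `p_c(ℤ³)`
(bond) the two-distinct-crossing-clusters event of `(Λ(n), Λ(⌈n^α⌉))` has probability `→ 0`, then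
for every `ε > 0`, for all large `n` and all `x, x' ∈ Λ(n) = box 3 n`,
`P_{p_c}(x ↔ x' inside Λ(⌈n^α⌉)) ≥ θ(p_c)² − ε`.

Proof (the bond transcription of Cerf, *A lower bound on the two-arms exponent for critical
percolation on the lattice*, Ann. Probab. 43 (2015), Lemma 10.1, arXiv:1306.3105 p. 15, followed
by a limit). Fix `n ≤ m` and `x, x' ∈ Λ(n)`.
* Harris–FKG (`harris_fkg_holds`) for the increasing measurable events `{|C(x)| = ∞}`,
  `{|C(x')| = ∞}` and translation invariance (`theta_zdGraph_eq_theta_zero`) give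
  `P(|C(x)| = ∞, |C(x')| = ∞) ≥ θ_x θ_{x'} = θ²`.
* First exit (`toBdry_of_percolatesAt`): on `{|C(x)| = ∞}` the vertex `x ∈ Λ(m)` is joined inside
  `Λ(m)` to a vertex of the inner vertex boundary `∂ⁱⁿΛ(m)`; likewise for `x'`. If moreover
  `x ↮ x'` inside `Λ(m)`, the configuration lies in the two-cluster event with witnesses
  `x, x', y, y'` (`mem_twoClusterEvent_of_percolatesAt`).
* Hence `θ² ≤ P(x ↔ x' in Λ(m)) + P(two-cluster event)` (`theta_sq_le_real_openConnIn_add`), and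
  the hypothesis `P(two-cluster event at n) → 0` gives `< ε` eventually; `n ≤ ⌈n^α⌉₊` for `α ≥ 1`.
No uniqueness of the infinite cluster is used.
-/

namespace Summit.CriticalPhenomena.PercolationContinuityZ3.Theorems

open MeasureTheory Filter
open Literature.Probability.LatticeModels Literature.Probability.Percolation
open Literature.Probability.Percolation.DCT16
open scoped Topology

variable {d : ℕ}

/-- **First exit, twice**: for `n ≤ m`, `x, x' ∈ Λ(n)` and a lattice configuration `ω ⊆ E(ℤ^d)`
in which both `C(x)` and `C(x')` are infinite but `x ↮ x'` inside `Λ(m)`, the configuration lies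
in the two-distinct-crossing-clusters event of `(Λ(n), Λ(m))`: there are `y, y' ∈ ∂ⁱⁿΛ(m)` with
`x ↔ y` and `x' ↔ y'` inside `Λ(m)` (initial segments of the two infinite paths up to their first
exits from `Λ(m)`) and `x ↮ x'` inside `Λ(m)`. (Cerf 2015, proof of Lemma 10.1.)
[cite: Cerf2015, Lemma 10.1] -/
theorem mem_twoClusterEvent_of_percolatesAt {n m : ℕ} (hnm : n ≤ m) {x x' : Site d}
    (hx : x ∈ box d n) (hx' : x' ∈ box d n) {ω : BondConfig (Site d)}
    (hω : ω ⊆ (zdGraph d).edgeSet) (h1 : ω ∈ percolatesAt x) (h2 : ω ∈ percolatesAt x')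
    (h3 : ω ∉ openConnIn (↑(box d m) : Set (Site d)) x x') :
    ω ∈ {ω : BondConfig (Site d) | ∃ x ∈ box d n, ∃ x' ∈ box d n,
      ∃ y ∈ innerBoundary (zdGraph d) (box d m), ∃ y' ∈ innerBoundary (zdGraph d) (box d m),
        ω ∈ openConnIn (↑(box d m) : Set (Site d)) x y ∧
          ω ∈ openConnIn (↑(box d m) : Set (Site d)) x' y' ∧
            ω ∉ openConnIn (↑(box d m) : Set (Site d)) x x'} := by
  obtain ⟨y, hy, hxy⟩ := toBdry_of_percolatesAt (box_mono d hnm hx) hω h1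
  obtain ⟨y', hy', hxy'⟩ := toBdry_of_percolatesAt (box_mono d hnm hx') hω h2
  exact ⟨x, hx, x', hx', y, hy, y', hy', hxy, hxy', h3⟩

/-- **Cerf's Lemma 10.1, bond version, at general `p`**: for `n ≤ m` and `x, x' ∈ Λ(n)`,
`θ(p)² ≤ P_p(x ↔ x' inside Λ(m)) + P_p(two-distinct-crossing-clusters event of (Λ(n), Λ(m)))`.
Harris–FKG for `{|C(x)| = ∞} ∩ {|C(x')| = ∞}`, translation invariance `θ_x = θ_0`, and the
inclusion `mem_twoClusterEvent_of_percolatesAt` up to the null set of configurations using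
non-edges (`real_mono_of_forall_subset_edgeSet`), then a union bound.
[cite: Cerf2015, Lemma 10.1] -/
theorem theta_sq_le_real_openConnIn_add (p : unitInterval) {n m : ℕ} (hnm : n ≤ m)
    {x x' : Site d} (hx : x ∈ box d n) (hx' : x' ∈ box d n) :
    theta (zdGraph d) 0 p ^ 2 ≤
      (bondPercolation (zdGraph d) p).real (openConnIn (↑(box d m) : Set (Site d)) x x') +
        (bondPercolation (zdGraph d) p).real {ω : BondConfig (Site d) | ∃ x ∈ box d n,
          ∃ x' ∈ box d n, ∃ y ∈ innerBoundary (zdGraph d) (box d m),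
            ∃ y' ∈ innerBoundary (zdGraph d) (box d m),
              ω ∈ openConnIn (↑(box d m) : Set (Site d)) x y ∧
                ω ∈ openConnIn (↑(box d m) : Set (Site d)) x' y' ∧
                  ω ∉ openConnIn (↑(box d m) : Set (Site d)) x x'} := by
  set μ := bondPercolation (zdGraph d) p with hμ
  set T : Set (BondConfig (Site d)) := {ω : BondConfig (Site d) | ∃ x ∈ box d n,
    ∃ x' ∈ box d n, ∃ y ∈ innerBoundary (zdGraph d) (box d m),
      ∃ y' ∈ innerBoundary (zdGraph d) (box d m),
        ω ∈ openConnIn (↑(box d m) : Set (Site d)) x y ∧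
          ω ∈ openConnIn (↑(box d m) : Set (Site d)) x' y' ∧
            ω ∉ openConnIn (↑(box d m) : Set (Site d)) x x'} with hT
  have hfkg : μ.real (percolatesAt x) * μ.real (percolatesAt x') ≤
      μ.real (percolatesAt x ∩ percolatesAt x') :=
    harris_fkg_holds (zdGraph d) p (isUpperSet_percolatesAt x) (isUpperSet_percolatesAt x')
      (measurableSet_percolatesAt_holds x) (measurableSet_percolatesAt_holds x')
  have hθx : μ.real (percolatesAt x) = theta (zdGraph d) 0 p := theta_zdGraph_eq_theta_zero p x
  have hθx' : μ.real (percolatesAt x') = theta (zdGraph d) 0 p := theta_zdGraph_eq_theta_zero p x'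
  have hincl : μ.real (percolatesAt x ∩ percolatesAt x') ≤
      μ.real (openConnIn (↑(box d m) : Set (Site d)) x x' ∪ T) :=
    real_mono_of_forall_subset_edgeSet (zdGraph d) p fun ω hω h => by
      by_cases hc : ω ∈ openConnIn (↑(box d m) : Set (Site d)) x x'
      · exact Or.inl hc
      · exact Or.inr (mem_twoClusterEvent_of_percolatesAt hnm hx hx' hω h.1 h.2 hc)
  calc theta (zdGraph d) 0 p ^ 2 = μ.real (percolatesAt x) * μ.real (percolatesAt x') := by
        rw [hθx, hθx', sq]
    _ ≤ μ.real (percolatesAt x ∩ percolatesAt x') := hfkg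
    _ ≤ μ.real (openConnIn (↑(box d m) : Set (Site d)) x x' ∪ T) := hincl
    _ ≤ μ.real (openConnIn (↑(box d m) : Set (Site d)) x x') + μ.real T :=
        measureReal_union_le _ _

/-- `n ≤ ⌈n^α⌉₊` for real `α ≥ 1`. [folklore] -/
theorem le_nat_ceil_rpow {α : ℝ} (hα : 1 ≤ α) (n : ℕ) : n ≤ ⌈(n : ℝ) ^ α⌉₊ := by
  have h1 : (n : ℝ) ≤ (n : ℝ) ^ α := by
    rcases Nat.eq_zero_or_pos n with rfl | hpos
    · rw [Nat.cast_zero]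
      exact Real.rpow_nonneg le_rfl α
    · exact Real.self_le_rpow_of_one_le (by exact_mod_cast hpos) hα
  exact_mod_cast h1.trans (Nat.le_ceil _)

/-- **Settles `stmt-CriticalPhenomena-5787`** (`JumpUniquenessBoxLRO`, exact route decl): for
every `α > 1`, if the two-distinct-crossing-clusters event of `(Λ(n), Λ(⌈n^α⌉))` has probability
`→ 0` at `p_c(ℤ³)`, then for every `ε > 0`, eventually in `n`, for all `x, x' ∈ Λ(n)`,
`θ(p_c)² − ε ≤ P_{p_c}(x ↔ x' inside Λ(⌈n^α⌉))`. From `theta_sq_le_real_openConnIn_add` at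
`m = ⌈n^α⌉₊ ≥ n` and `Tendsto → eventually < ε`. [cite: Cerf2015, Lemma 10.1] -/
theorem jumpUniquenessBoxLRO_proof :
    Summit.CriticalPhenomena.PercolationContinuityZ3.Theses.PercShatteringRace.JumpUniquenessBoxLRO := by
  unfold Summit.CriticalPhenomena.PercolationContinuityZ3.Theses.PercShatteringRace.JumpUniquenessBoxLRO
  intro α hα hT ε hε
  filter_upwards [hT.eventually (gt_mem_nhds hε)] with n hn x hx x' hx'
  have h := theta_sq_le_real_openConnIn_add (criticalProbI 3) (le_nat_ceil_rpow hα.le n) hx hx'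
  linarith

end Summit.CriticalPhenomena.PercolationContinuityZ3.Theorems
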